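import Literature.MathematicalPhysics.QuantumLattice.HubbardHubbardModel
import Literature.MathematicalPhysics.QuantumLattice.HubbardModelThermodynamicLimitProofs
import HarnessLib

/-!
# The Lieb–Wu solution of the half-filled Hubbard chain: Bethe-ansatz decomposition of `lieb_wu`

Family `hubbard` (trunk T-QLATTICE), statement hubbard.S10. This file decomposes the named fact
`Literature.MathematicalPhysics.QuantumLattice.lieb_wu` (`Literature/MathematicalPhysics/QuantumLattice/HubbardHubbardModel.lean`:
for `U > 0`, along the rings of even length `L = 2n → ∞` at half filling `N = L`, (i) the
ground-state energy per site of the Hubbard chain with `t = 1` tends to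
`liebWuEnergy U = -4 ∫₀^∞ J₀J₁/(ω(1 + e^{ωU/2})) dω` and (ii) the charge gap
`E(N+1) + E(N-1) - 2E(N)` tends to `liebWuChargeGap U = U - 4 + 8 ∫₀^∞ J₁/(ω(1 + e^{ωU/2})) dω`)
into the intermediate results of the printed derivation, each vendored as a named fact
(`def … : Prop`, D-0014) with its own cite, and PROVES the assembly
`lieb_wu_of_roots : F1 → F2′ → F3 → F4 → F5a → F5b → lieb_wu` (and the two halves
`lieb_wu_energy_of'`, `lieb_wu_chargeGap_of`; the earlier `lieb_wu_of : F2 → F3 → F4 → F5a → F5b →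
lieb_wu` is kept but its hypothesis F2 is false at `m = 0`, see F2′). Nothing in
`HubbardHubbardModel.lean` is restated or changed.

## The printed architecture (Lieb–Wu 1968/2003, Goldbaum 2005)

Units: Lieb–Wu and Goldbaum write `H = T Σ_{⟨ij⟩σ} c†_{iσ} c_{jσ} + U Σ n_{i↑} n_{i↓}` with `T = -1`
(Lieb–Wu 2003, §1, after eq. (1)); this is `Literature.Hubbard.hamiltonian G 1 U` (`-t Σ c†c`, `t = 1`).
`N_a` = number of sites (`L` here), `N` electrons, `M` down and `M' = N - M` up spins.

1. (Bethe ansatz, Lieb–Wu 2003 §3.) For real, ordered, unequal `k₁ < ⋯ < k_N` and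
   `Λ₁ < ⋯ < Λ_M` solving the **Lieb–Wu equations**
   `N_a k_j = 2π I_j + Σ_β θ(2 sin k_j - 2Λ_β)`,
   `Σ_j θ(2 sin k_j - 2Λ_α) = 2π J_α - Σ_β θ(Λ_α - Λ_β)`, `θ(p) = -2 arctan(2p/U)`
   (`IsLiebWuRoots`), the Bethe wave function — if it is not identically
   zero — is an eigenvector with energy `E = -2 Σ_j cos k_j` (`betheEnergy`). For the ground state
   with `N = 2 × odd`, `M = N/2` odd, the quantum numbers are `I_j = j - (N+1)/2`,
   `J_α = α - (M+1)/2` (`liebWuGroundNumbers`). Lieb–Wu require `N_a = 2 × (odd integer)` so that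
   `M = M' = N_a/2` is odd at half filling (2003, §2, p. 4 of arXiv:cond-mat/0207529).
2. (Existence, Goldbaum 2005 Thm 1.1.) For `N` even and `M` odd these equations have a real
   solution with `-π ≤ k₁ < ⋯ < k_N ≤ π`, `Λ₁ < ⋯ < Λ_M`, lying on a continuous curve of solutions
   from `U = ∞` to any `U > 0` (`goldbaum_liebWuGroundRoots_exists`, F1, half-filled case).
3. (Ground state, Goldbaum 2005 §4 with Lieb–Wu 2003 §2 items 1.–2. and §3 (a)–(b).) The ground
   state in the sector `(M, M')`, `M, M'` odd, is unique for every `U` (Perron–Frobenius on the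
   region `R`); the Bethe state is the ground state at `U = ∞`; along Goldbaum's curve the roots
   are algebraic in `U`, the Bethe norm vanishes for at most finitely many `U`, and redefining the
   state there by limits shows "the Bethe Ansatz gives us the true ground state of the system for
   any `U > 0`". Hence (F2c, `liebWu_minEnergyOn_szSector_eq_betheEnergy`) the lowest energy of
   the sector `M = M' = 2m + 1` on the ring of `4m + 2` sites is `-2 Σ cos k_j` for suitable
   ground-state roots, and (F2′, `liebWu_groundEnergyAt_eq_betheEnergy'`) so is the ground-state
   energy at half filling over all `S^z` (every spin multiplet has an `S^z = 0` member).
4. (Thermodynamic limit, Goldbaum 2005 §5 with Lieb–Wu 2003 §§4–6.) At half filling the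
   empirical root densities of any such family converge to Lieb–Wu's `ρ₀`, `σ₀`
   (2003, §6, boxed formulas; Goldbaum (5.16)–(5.17)), "which yield the ground state energy"
   `E₀(N_a/2, N_a/2) = -4 N_a ∫₀^∞ J₀(ω)J₁(ω)/(ω(1 + e^{ωU/2})) dω` (2003, §6, boxed). This is F3,
   `liebWu_betheEnergy_tendsto`.
   CAVEAT (`N_a = 2`): Lieb–Wu's ring Hamiltonian sums `c†_{iσ} c_{i+1,σ} + h.c.` over
   `i = 1, …, N_a` with `N_a + 1 ≡ 1`, which for `N_a = 2` is a double bond, whereas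
   `hubbardChain 2` has a single bond; the finite-ring identification is therefore vendored for
   `N_a = 4m + 2 ≥ 6` only (F2′, F2c), and F1 supplies roots on all rings.
5. (All even lengths.) Items 1–4 give (i) along `L = 4m + 2`. For `L = 4m` (`M = L/2` even, not
   covered by the printed Bethe-ansatz analysis) one needs that the thermodynamic limit of the
   energy per site exists along all even rings (F4, `hubbardChain_energyPerSite_limit_exists`,
   folklore subadditivity); then the limit is identified on the subsequence `L = 4m + 2`.
6. (Charge gap.) Particle–hole symmetry on the even ring gives
   `E(M, M') = -(N_a - N)U + E(N_a - M, N_a - M')` (Lieb–Wu 2003, §1, eq. (3)), whence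
   `E(N_a + 1) = E(N_a - 1) + U` and `μ₊ + μ₋ = U` for `μ₊ = E(N_a+1) - E(N_a)`,
   `μ₋ = E(N_a) - E(N_a-1)` (Essler et al. 2005, (6.32)–(6.34)); this is F5a,
   `hubbardChain_groundEnergyAt_particleHole`. Lieb–Wu compute
   `μ₋(U) = 2 - 4 ∫₀^∞ J₁(ω)/(ω(1 + e^{ωU/2})) dω` (2003, §7, boxed formula; PRL 1968) — F5b,
   `liebWu_muMinus_tendsto` — so that `μ₊ - μ₋ = U - 2μ₋ = liebWuChargeGap U`
   (Essler et al. (6.35); `liebWuChargeGap_eq`).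

## Rigour status of the nodes (read before attempting `_holds` discharges)

* F1, F3: theorems in print (Goldbaum 2005, Thm 1.1 and §5; Lieb–Wu 2003 Thm 1 and §6).
* F2: printed as a proof in prose (Goldbaum 2005 §4, resting on Lieb–Wu 2003 §2); Lieb–Wu 2003
  themselves (§3 and §8) list the ground-state identification as open at the time. As first
  vendored (F2, all `m`) the node is FALSE at `m = 0` (`N_a = 2`: single versus double bond, see
  the docstring of F2′; refuted in `LiebWuBetheAnsatzProofs`); it is superseded by F2′ (`m ≥ 1`) and the assembly `lieb_wu_of_roots`
  (with F1 supplying roots on all rings). DECOMPOSED: F2′ follows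
  (`LiebWuBetheAnsatzProofs.liebWu_groundEnergyAt_eq_betheEnergy'_of_szSector`) from its sector
  form F2c (`liebWu_minEnergyOn_szSector_eq_betheEnergy`: Goldbaum §4 in the sector
  `M = M' = 2m + 1`, `m ≥ 1`) by the PROVED `SU(2)` reduction
  `groundEnergyAt_eq_minEnergyOn_szSector` (`HubbardRingPerronFrobeniusProofs`). Of the printed
  ingredients of F2c, the uniqueness and positivity of the sector ground state for all `U`
  (Lieb–Wu 2003, §2, items 1.–2., Perron–Frobenius) is PROVED
  (`liebWu_isGroundStateInSector_ring`, `HubbardRingPerronFrobeniusProofs`, on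
  `PerronFrobeniusGroundState`); the Bethe-ansatz eigenvector theorem (Lieb–Wu 1968,
  eqs. (3)–(11)) and Goldbaum's continuity/algebraicity argument (Thm 1.1, §4) remain.
  CENSUS of what remains for F2c (recorded when F2 itself was closed as mis-stated; F2 is the
  conjunction of F2′ and its false instance `m = 0`, `liebWu_groundEnergyAt_eq_betheEnergy_iff`):
  (1) the nested Bethe-ansatz eigenvector theorem — NOW PROVED in the tree (2026-08-15):
  `HubbardBA.betheVector_of_isLiebWuGroundRoots` (`LiebWuBetheEigenvector.lean`): for `U ≠ 0`,
  `m ≥ 1` and `IsLiebWuGroundRoots U m k Λ` the Bethe vector `Φ = HubbardBA.betheVector (U/4) k Λ`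
  (Essler et al. (2005) (3.89)–(3.91) = Lieb–Wu 1968 eqs. (3)–(8), built on the algebraic Bethe
  ansatz of the inhomogeneous XXX chain, `XXXAlgebraicBetheAnsatz.lean`,
  `XXXBetheVectorTransport.lean`, the wave function on `ℤ^N` with its Schrödinger equation and
  periodicity, `LiebWuBetheWaveFunction.lean`, and first quantisation on the Fock space,
  `FockFirstQuantization.lean`) satisfies `hamiltonian (hubbardChain (4m+2)) 1 U *ᵥ Φ =
  betheEnergy k • Φ` and `Φ ∈ szSector (4m+2) 0`; what (1) does NOT give is `Φ ≠ 0` (Essler et al.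
  §3.5 conjecture the norm formula; Goldbaum 2005 Thm 4.2 proves non-vanishing only for
  `N_a ≥ N + M`, not at half filling), see (3)–(4); (2) the continuity principle — PROVED
  (`liebWu_eigenvalue_continuation`, `HubbardRingGroundStateContinuityProofs`, on the abstract
  `SectorEigenvalueContinuation`), parametrised by the coupling `U ∈ S ⊆ ℝ` itself, whereas
  Goldbaum's connected set of solutions need not be a graph over `U` (a version over a preconnected
  parameter space is what §4 uses); (3) Goldbaum's connected set of solutions from any `U₀ > 0` to
  arbitrarily large `U` (§3: inward-pointing field on `∂Ω`, index count, polynomial approximation)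
  and the generic non-vanishing of the Bethe vector along it (§4: elimination, roots algebraic in
  `U`, finitely many zeros and poles, redefinition by limits of normalised eigenvectors; Thm 4.2
  covers `N/N_a ≤ 2/3` only, not half filling) — NOT in the tree (F1 is the pointwise existence);
  (4) the ANCHOR of the continuation: both sources start it at `U = ∞` (Goldbaum 2005, §1: the
  `I_j`, `J_α` "give us the correct solution in the limit `U → ∞`"; Lieb–Wu 2003, §3: the ansatz
  "coincides with the exact solution for `U = ∞`"), but at half filling the rescaled sector
  Hamiltonian `H/U → Σ_x n_{x↑} n_{x↓}` (`U → ∞`) has the whole singly-occupied subspace of the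
  sector `(4m + 2, S^z = 0)` as its zero-energy ground space, so the lowest eigenvalue is NOT
  simple at the anchor and the clopen argument of (2) cannot be started there; a finite-`U` anchor
  needs the order-`t²/U` (antiferromagnetic Heisenberg ring) splitting of this degeneracy together
  with the identification of the Heisenberg ring's ground state (`M` odd) with its Bethe state
  (a Yang–Yang 1966-type continuity in the anisotropy), and neither source prints such an argument
  (Lieb–Wu 2003, §2 and §3, list the identification as an open problem). F2c and F2′ therefore
  remain named facts whose discharge is not available from print as it stands.
* F4: not in the Lieb–Wu papers (they fix `N_a = 2 × odd`); folklore (Fekete). PROVED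
  (`HubbardModelThermodynamicLimitProofs`: ring cut + subadditivity; discharged at the end of this
  file, `hubbardChain_energyPerSite_limit_exists_holds`).
* F5a: elementary (unitary particle–hole conjugation), printed as Lieb–Wu 2003 eq. (3). PROVED
  (`HubbardModelParticleHoleProofs`; discharged at the end of this file,
  `hubbardChain_groundEnergyAt_particleHole_holds`).
* F5b: NO printed proof. Lieb–Wu 2003 §7 *define* `μ_±` as the one-sided derivatives at `n = 1`
  of the convex infinite-volume energy density `e(n)` and compute `μ₋` by a leading-order
  perturbation of the integral equations (§7.1) and, formally, from the Bethe ansatz with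
  `N_a - 4` electrons (§7.2); PRL 1968 and Essler et al. (6.32) state it for the finite
  differences `E(L) - E(L-1)`. Part (ii) of `lieb_wu` therefore transcribes an announced and
  universally accepted, but not rigorously proved, result; `lieb_wu` itself is unchanged.

## Design notes

* Quantum numbers are 0-based: `liebWuGroundNumbers n i = i - (n - 1)/2` for `i : Fin n` is
  Lieb–Wu's `j - (n + 1)/2`, `j = i + 1 ∈ {1, …, n}`; the same formula serves `I` (`n = N`) and
  `J` (`n = M`).
* Half filling on the rings covered by the sources is parametrised as `N = N_a = 4m + 2`,
  `M = 2m + 1` (`IsLiebWuGroundRoots U m k Λ`); the root bounds `-π ≤ k_j ≤ π` and strict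
  monotonicity are exactly Goldbaum's Theorem 1.1.
* F2 is existential in the roots (uniqueness of the solution of the Lieb–Wu equations is not
  proved in print: Lieb–Wu 2003 §3 "presumably unique"; Goldbaum "at least one").
* `liebWuMuMinus U = 2 - 4 ∫₀^∞ J₁/(ω(1 + e^{ωU/2}))` reuses `liebWuChargeGapIntegrand` of
  `LiebWuIntegrals`; `liebWuChargeGap U = U - 2 · liebWuMuMinus U` is `liebWuChargeGap_eq_muMinus`.
* Mathlib search: `rg -i 'bethe|lieb.wu|hubbard'` over Mathlib finds nothing; `Real.arctan`,
  `StrictMono`, `Filter.Tendsto`, `tendsto_nhds_unique` are Mathlib's.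

## Sources

* E. H. Lieb, F. Y. Wu, *Absence of Mott transition in an exact solution of the short-range,
  one-band model in one dimension*, PRL 20 (1968) 1445 (announcement; key `LiebWuPRL1968`);
  read in the reprint A. Montorsi (ed.), *The Hubbard Model — A Reprint Volume*, World
  Scientific (1992), [2.1], pp. 63–68 (held): eq. (3) (first-quantised equation), (5) (ansatz),
  (6) (`E = -2 Σ cos k_j`), (9)–(11) (Lieb–Wu equations and the parity rules for `I_j`, `J_α`),
  (20) (`E(N_a/2, N_a/2; U)`), (21) (`μ_± := E(M±1∓0, M) - …`, finite differences of sector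
  energies), (22) (`μ₊ = U - μ₋`), (23) (`μ₋`).
* E. H. Lieb, F. Y. Wu, *The one-dimensional Hubbard model: a reminiscence*, Physica A 321 (2003)
  1–27 = arXiv:cond-mat/0207529 (held; key `LiebWuPhysicaA2003`): §1 eq. (3); §2 items 1.–2.;
  §3 (Lieb–Wu equations, (a), (b)); §5 Theorem 1; §6 boxed `ρ₀, σ₀, E₀`; §7 boxed `μ₋`; §8.
* P. S. Goldbaum, *Existence of solutions to the Bethe ansatz equations for the 1D Hubbard model:
  finite lattice and thermodynamic limit*, CMP 258 (2005) 317–337 = arXiv:cond-mat/0403736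
  (held; key `Goldbaum2005`): Thm 1.1, §4 (Thm 4.2), §5 (5.1)–(5.17), §6.
* F. H. L. Essler, H. Frahm, F. Göhmann, A. Klümper, V. E. Korepin, *The One-Dimensional Hubbard
  Model*, CUP 2005 (held; key `EsslerEtAl2005`): §6.3, eqs. (6.31)–(6.35), pp. 199–200.
-/

noncomputable section

namespace Literature.MathematicalPhysics.QuantumLattice

open Filter Finset MeasureTheory
open scoped Topology BigOperators Real

/-! ### The Lieb–Wu equations -/

/-- The Lieb–Wu phase function `θ(p) = -2 arctan(2p/U)` (values in `(-π, π)`).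
Lieb–Wu, Physica A 321 (2003) 1, §3 (definition preceding the Lieb–Wu equations); Goldbaum,
CMP 258 (2005) 317, §1 (before eq. (1.5)). [cite: LiebWuPhysicaA2003, §3] -/
def liebWuTheta (U p : ℝ) : ℝ := -2 * Real.arctan (2 * p / U)

/-- `θ` is odd. [cite: LiebWuPhysicaA2003, §3] -/
@[simp] theorem liebWuTheta_neg (U p : ℝ) : liebWuTheta U (-p) = -liebWuTheta U p := by
  simp [liebWuTheta, neg_div, Real.arctan_neg]

/-- `θ(0) = 0`. [cite: LiebWuPhysicaA2003, §3] -/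
@[simp] theorem liebWuTheta_zero (U : ℝ) : liebWuTheta U 0 = 0 := by
  simp [liebWuTheta]

/-- `|θ(p)| < π` (Lieb–Wu take `-π ≤ θ ≤ π`). [cite: LiebWuPhysicaA2003, §3] -/
theorem abs_liebWuTheta_lt (U p : ℝ) : |liebWuTheta U p| < π := by
  have h₁ := Real.arctan_lt_pi_div_two (2 * p / U)
  have h₂ := Real.neg_pi_div_two_lt_arctan (2 * p / U)
  rw [liebWuTheta, abs_lt]
  constructor <;> linarith

/-- The ground-state quantum numbers of Lieb–Wu: `n` consecutive integers or half-odd integers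
centred at the origin, `i - (n - 1)/2` for `i = 0, …, n - 1` (Lieb–Wu's `I_j = j - (N + 1)/2`,
`j = 1, …, N`, and `J_α = α - (M + 1)/2`, `α = 1, …, M`, with `i = j - 1`, resp. `i = α - 1`).
Lieb–Wu, Physica A 321 (2003) 1, §3 (choice of `I_j`, `J_α` for the ground state); Goldbaum,
CMP 258 (2005) 317, §1. [cite: LiebWuPhysicaA2003, §3] -/
def liebWuGroundNumbers (n : ℕ) (i : Fin n) : ℝ := (i : ℝ) - ((n : ℝ) - 1) / 2

/-- The ground-state quantum numbers are balanced: `I_{n-1-i} = -I_i`.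
[cite: LiebWuPhysicaA2003, §3] -/
theorem liebWuGroundNumbers_rev {n : ℕ} (i : Fin n) :
    liebWuGroundNumbers n (Fin.rev i) = -liebWuGroundNumbers n i := by
  have h : ((Fin.rev i : ℕ) : ℝ) = (n : ℝ) - 1 - (i : ℝ) := by
    have := i.isLt
    rw [Fin.val_rev]
    push_cast [Nat.cast_sub (by omega : i + 1 ≤ n)]
    ring
  simp only [liebWuGroundNumbers, h]
  ring

/-- The ground-state quantum numbers sum to zero, so that the total momentum
`k_total = (2π/N_a)(Σ_j I_j + Σ_α J_α)` of the Bethe ground state vanishes.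
Lieb–Wu, Physica A 321 (2003) 1, §3 (formula for `k_total`). [cite: LiebWuPhysicaA2003, §3] -/
theorem sum_liebWuGroundNumbers (n : ℕ) : ∑ i, liebWuGroundNumbers n i = 0 := by
  have h : ∑ i : Fin n, ((i : ℕ) : ℝ) = (n : ℝ) * ((n : ℝ) - 1) / 2 := by
    rw [Fin.sum_univ_eq_sum_range (fun i => (i : ℝ)) n]
    have h2 : ((∑ i ∈ range n, i : ℕ) : ℝ) * 2 = (n : ℝ) * ((n : ℝ) - 1) := by
      rcases Nat.eq_zero_or_pos n with rfl | hn
      · simp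
      · have hc : ((n * (n - 1) : ℕ) : ℝ) = (n : ℝ) * ((n : ℝ) - 1) := by
          push_cast [Nat.cast_sub hn]
          ring
        rw [← hc, ← Finset.sum_range_id_mul_two n]
        push_cast
        ring
    push_cast at h2 ⊢
    linarith
  simp only [liebWuGroundNumbers, Finset.sum_sub_distrib, Finset.sum_const, Finset.card_univ,
    Fintype.card_fin, nsmul_eq_mul, h]
  ring

/-- The **Lieb–Wu equations** for `N` electrons, `M` of them with spin down, on a ring of `Na`
sites, with interaction `U` and quantum numbers `I : Fin N → ℝ`, `J : Fin M → ℝ`: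
`Na · k_j = 2π I_j + Σ_β θ(2 sin k_j - 2Λ_β)` (`j < N`) and
`Σ_j θ(2 sin k_j - 2Λ_α) = 2π J_α - Σ_β θ(Λ_α - Λ_β)` (`α < M`), `θ = liebWuTheta U`
(the logarithmic form of the Bethe-ansatz equations of Gaudin–Yang type for the lattice).
Lieb–Wu, PRL 20 (1968) 1445; Physica A 321 (2003) 1, §3 (the two displayed sets of equations
following the definition of `θ`); Goldbaum, CMP 258 (2005) 317, eqs. (1.5)–(1.6).
[cite: LiebWuPhysicaA2003, §3] [cite: Goldbaum2005, eqs. (1.5)–(1.6)] -/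
def IsLiebWuRoots (U : ℝ) (Na : ℕ) {N M : ℕ} (I : Fin N → ℝ) (J : Fin M → ℝ)
    (k : Fin N → ℝ) (Λ : Fin M → ℝ) : Prop :=
  (∀ j, (Na : ℝ) * k j = 2 * π * I j + ∑ β, liebWuTheta U (2 * Real.sin (k j) - 2 * Λ β)) ∧
    ∀ α, ∑ j, liebWuTheta U (2 * Real.sin (k j) - 2 * Λ α) =
      2 * π * J α - ∑ β, liebWuTheta U (Λ α - Λ β)

/-- Without down spins (`M = 0`, "the case `M = 0` is trivial") the Lieb–Wu equations reduce to
the free-fermion quantisation `Na · k_j = 2π I_j`. Lieb–Wu, Physica A 321 (2003) 1, §3.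
[cite: LiebWuPhysicaA2003, §3] -/
theorem isLiebWuRoots_zero_iff (U : ℝ) (Na : ℕ) {N : ℕ} (I : Fin N → ℝ) (J : Fin 0 → ℝ)
    (k : Fin N → ℝ) (Λ : Fin 0 → ℝ) :
    IsLiebWuRoots U Na I J k Λ ↔ ∀ j, (Na : ℝ) * k j = 2 * π * I j := by
  simp [IsLiebWuRoots]

/-- **Ground-state roots at half filling.** On the ring of `N_a = 4m + 2` sites with
`N = 4m + 2` electrons, `M = 2m + 1` (odd) of spin down and `M' = 2m + 1` of spin up: real
roots `k`, `Λ` of the Lieb–Wu equations with the ground-state quantum numbers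
`liebWuGroundNumbers`, strictly
increasing, with `-π ≤ k_j ≤ π` — exactly the solutions provided by Goldbaum's Theorem 1.1.
Lieb–Wu, Physica A 321 (2003) 1, §2 (p. 4: `N_a = 2 × odd`) and §3; Goldbaum, CMP 258 (2005)
317, Thm 1.1. [cite: Goldbaum2005, Theorem 1.1] [cite: LiebWuPhysicaA2003, §3] -/
def IsLiebWuGroundRoots (U : ℝ) (m : ℕ) (k : Fin (4 * m + 2) → ℝ) (Λ : Fin (2 * m + 1) → ℝ) :
    Prop :=
  IsLiebWuRoots U (4 * m + 2) (liebWuGroundNumbers (4 * m + 2)) (liebWuGroundNumbers (2 * m + 1))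
      k Λ ∧
    StrictMono k ∧ StrictMono Λ ∧ ∀ j, k j ∈ Set.Icc (-π) π

/-- The **Bethe-ansatz energy** `E = -2 Σ_j cos k_j` of a Bethe state with momenta `k`
(hopping `T = -1`, i.e. `t = 1` in `Literature.MathematicalPhysics.QuantumLattice.hamiltonian`). Lieb–Wu, Physica A 321 (2003) 1,
§3, displayed formula `E = E(M, M') = -2 Σ_{j=1}^N cos k_j`. [cite: LiebWuPhysicaA2003, §3] -/
def betheEnergy {N : ℕ} (k : Fin N → ℝ) : ℝ := -2 * ∑ j, Real.cos (k j)

/-- The Bethe energy of `N` momenta lies in `[-2N, 2N]` (`|cos| ≤ 1`). [folklore] -/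
theorem abs_betheEnergy_le {N : ℕ} (k : Fin N → ℝ) : |betheEnergy k| ≤ 2 * N := by
  have h : |∑ j, Real.cos (k j)| ≤ N := by
    calc |∑ j, Real.cos (k j)| ≤ ∑ j : Fin N, |Real.cos (k j)| := abs_sum_le_sum_abs _ _
      _ ≤ ∑ _j : Fin N, (1 : ℝ) := sum_le_sum fun j _ => Real.abs_cos_le_one _
      _ = N := by simp
  rw [betheEnergy, abs_mul]
  norm_num
  linarith

/-- Lieb–Wu's chemical potential for removing an electron from the half-filled chain,
`μ₋(U) = 2 - 4 ∫₀^∞ J₁(ω) / (ω (1 + e^{ωU/2})) dω` (integrand `liebWuChargeGapIntegrand` of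
`LiebWuIntegrals`). Lieb–Wu, Physica A 321 (2003) 1, §7 (boxed formula for `μ₋(U)`); PRL 20
(1968) 1445; Essler et al. (2005) eq. (6.31) (with `U = 4u` and their shift `-2u`).
[cite: LiebWuPhysicaA2003, §7] [cite: EsslerEtAl2005, eq. (6.31)] -/
def liebWuMuMinus (U : ℝ) : ℝ := 2 - 4 * ∫ ω in Set.Ioi (0 : ℝ), Literature.Analysis.FunctionSpaces.liebWuChargeGapIntegrand U ω

/-- `μ₊ - μ₋ = U - 2μ₋`: the Lieb–Wu charge gap in terms of `μ₋` (using `μ₊ + μ₋ = U`).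
Lieb–Wu, Physica A 321 (2003) 1, §7; Essler et al. (2005) eq. (6.35).
[cite: LiebWuPhysicaA2003, §7] -/
theorem liebWuChargeGap_eq_muMinus (U : ℝ) : Literature.Analysis.FunctionSpaces.liebWuChargeGap U = U - 2 * liebWuMuMinus U := by
  rw [Literature.Analysis.FunctionSpaces.liebWuChargeGap, liebWuMuMinus]
  ring

/-! ### The named facts F1–F5b -/

/-- **F1 (Goldbaum's existence theorem, half-filled case).** For every `U > 0` and every ring of
`4m + 2` sites, the Lieb–Wu equations at half filling (`N = 4m + 2` even, `M = 2m + 1` odd) with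
the ground-state quantum numbers have a real solution with `-π ≤ k₁ < ⋯ < k_N ≤ π` and
`Λ₁ < ⋯ < Λ_M`. (Goldbaum proves this for all `N` even, `M` odd, together with a continuous curve
of solutions from `U = ∞`; only the half-filled specialisation is vendored.)
Goldbaum, CMP 258 (2005) 317, Theorem 1.1. [cite: Goldbaum2005, Theorem 1.1] -/
def goldbaum_liebWuGroundRoots_exists : Prop :=
  ∀ (U : ℝ) (_hU : 0 < U) (m : ℕ),
    ∃ (k : Fin (4 * m + 2) → ℝ) (Λ : Fin (2 * m + 1) → ℝ), IsLiebWuGroundRoots U m k Λ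

/-- **F2 (the Bethe state is the ground state; finite ring).** For `U > 0`, on the Hubbard ring of
`4m + 2` sites with `t = 1` at half filling `N = 4m + 2`, the ground-state energy in the
`N`-particle sector (all `S^z`; for even `N` it is attained at `S^z = 0`, `M = M' = 2m + 1`, by the
`SU(2)` symmetry) equals the Bethe energy `-2 Σ_j cos k_j` of some ground-state roots of the
Lieb–Wu equations. Printed argument: uniqueness of the ground state in the sector `(M, M')` with
`M, M'` odd for all `U` (Lieb–Wu 2003, §2, items 1.–2.), coincidence with the exact ground state
at `U = ∞`, continuity along Goldbaum's curve of solutions and non-vanishing of the Bethe wave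
function off finitely many `U` (Goldbaum 2005, §§3–4: "That concludes the proof that the Bethe
Ansatz gives us the true ground state of the system for any `U > 0`"). Existential in the roots:
uniqueness of the solution is not proved in print. **SUPERSEDED by F2′
(`liebWu_groundEnergyAt_eq_betheEnergy'`): as stated, for ALL `m`, this Prop is FALSE
(PROVED: `LiebWuBetheAnsatzProofs.not_liebWu_groundEnergyAt_eq_betheEnergy`), because its case
`m = 0` fails** — `hubbardChain 2` has a single bond, whereas the Lieb–Wu equations with
`N_a = 2` encode the translation-invariant two-site ring with a double bond (see F2′); the
assembly `lieb_wu_of` below is therefore only of historical interest and `lieb_wu_of_roots` is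
the one to discharge. Goldbaum, CMP 258 (2005) 317, §4 and §6; Lieb–Wu, Physica A 321 (2003)
1, §2 and §3 (a)–(b). [cite: Goldbaum2005, §4] [cite: LiebWuPhysicaA2003, §2 items 1–2, §3 (a)–(b)] -/
def liebWu_groundEnergyAt_eq_betheEnergy : Prop :=
  ∀ (U : ℝ) (_hU : 0 < U) (m : ℕ),
    ∃ (k : Fin (4 * m + 2) → ℝ) (Λ : Fin (2 * m + 1) → ℝ), IsLiebWuGroundRoots U m k Λ ∧
      groundEnergyAt (hubbardChain (4 * m + 2)) 1 U (4 * m + 2) = betheEnergy k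

/-- **F2′ (the Bethe state is the ground state; finite rings of at least six sites).** For
`U > 0` and `m ≥ 1`, on the Hubbard ring of `N_a = 4m + 2` sites with `t = 1` at half filling
`N = 4m + 2`, the ground-state energy in the `N`-particle sector equals the Bethe energy
`-2 Σ_j cos k_j` of some ground-state roots of the Lieb–Wu equations (printed argument as in the
docstring of F2). The restriction `m ≥ 1` repairs F2: Lieb–Wu's ring Hamiltonian is
`T Σ_{i} Σ_σ (c†_{iσ} c_{i+1,σ} + c†_{i+1,σ} c_{iσ})`, `N_a + 1 ≡ 1` (Physica A 321 (2003) 1, §2,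
first paragraph), which for `N_a = 2` is twice the single bond of `hubbardChain 2`
(`HubbardHubbardModel`: "for `L = 2` the two bonds of the ring coincide"); accordingly for
`N_a = N = 2`, `M = 1` the Lieb–Wu equations with the ground-state numbers `I = (-1/2, 1/2)`,
`J = 0` force `k₂ = -k₁ = π/2 - arctan(4s/U)`, `Λ = 0` with `s = sin k₂ > 0`,
`16s⁴ + U²s² = U²`, and Bethe energy `-4 cos k₂ = (U - √(U² + 64))/2`, the ground-state energy of
the doubly-bonded pair, while that of `hubbardChain 2` is `(U - √(U² + 16))/2`. For `N_a ≥ 3` the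
two Hamiltonians coincide, so nothing is lost for `lieb_wu` (a statement about `N_a → ∞`).
Goldbaum, CMP 258 (2005) 317, §4; Lieb–Wu, Physica A 321 (2003) 1, §2 and §3 (a)–(b).
[cite: Goldbaum2005, §4] [cite: LiebWuPhysicaA2003, §2 items 1–2, §3 (a)–(b)] -/
def liebWu_groundEnergyAt_eq_betheEnergy' : Prop :=
  ∀ (U : ℝ) (_hU : 0 < U) (m : ℕ) (_hm : 1 ≤ m),
    ∃ (k : Fin (4 * m + 2) → ℝ) (Λ : Fin (2 * m + 1) → ℝ), IsLiebWuGroundRoots U m k Λ ∧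
      groundEnergyAt (hubbardChain (4 * m + 2)) 1 U (4 * m + 2) = betheEnergy k

/-- **F2c (the Bethe state is the ground state of its sector; Goldbaum 2005 §4).** For `U > 0`,
on the Hubbard ring of `4m + 2` sites with `t = 1`, the lowest energy of `H` in the joint sector
`(N, S^z) = (4m + 2, 0)`, i.e. `M = M' = 2m + 1` down/up electrons (both odd — the sector in
which Lieb–Wu and Goldbaum work), equals the Bethe energy `-2 Σ_j cos k_j` of some ground-state
roots of the Lieb–Wu equations. This is the sector form of F2′; F2′ follows from it by the `SU(2)`
reduction `groundEnergyAt_eq_minEnergyOn_szSector` (PROVED, `HubbardRingPerronFrobeniusProofs`;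
assembly in `LiebWuBetheAnsatzProofs`). Printed proof: the Bethe vector built on the roots solves
`H ψ = E ψ` with `E = -2 Σ cos k_j` (Lieb–Wu 1968, eqs. (3)–(11)); the ground state of the sector
is unique for every `U` since `M`, `M'` are odd (Lieb–Wu 2003, §2, items 1.–2. — PROVED as
`liebWu_isGroundStateInSector_ring`); along Goldbaum's continuous curve of solutions from
`U = ∞`, where the Bethe state is the ground state, the roots are algebraic in `U` and the Bethe
vector vanishes for at most finitely many `U`, where the state is redefined by limits ("That
concludes the proof that the Bethe Ansatz gives us the true ground state of the system for any
`U > 0`"). Existential in the roots, as F2. Restricted to `m ≥ 1` (`N_a ≥ 6`): for `N_a = 2`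
the Lieb–Wu equations describe the doubly-bonded two-site ring, not `hubbardChain 2` (see F2′).
Goldbaum, CMP 258 (2005) 317, §4 (and Thm 1.1); Lieb–Wu, Physica A 321 (2003) 1, §2 items
1.–2., §3 (a)–(b); Lieb–Wu, PRL 20 (1968) 1445, eqs. (3)–(11). [cite: Goldbaum2005, §4]
[cite: LiebWuPhysicaA2003, §3 (a)–(b)] -/
def liebWu_minEnergyOn_szSector_eq_betheEnergy : Prop :=
  ∀ (U : ℝ) (_hU : 0 < U) (m : ℕ) (_hm : 1 ≤ m),
    ∃ (k : Fin (4 * m + 2) → ℝ) (Λ : Fin (2 * m + 1) → ℝ), IsLiebWuGroundRoots U m k Λ ∧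
      (hamiltonian (hubbardChain (4 * m + 2)) 1 U).minEnergyOn (szSector (4 * m + 2) 0) =
        betheEnergy k

/-- **F3 (thermodynamic limit of the Bethe energies at half filling).** For `U > 0` and ANY family
of ground-state roots of the Lieb–Wu equations on the rings of `4m + 2` sites at half filling,
the Bethe energy per site converges, as `m → ∞`, to the Lieb–Wu energy
`-4 ∫₀^∞ J₀(ω)J₁(ω)/(ω(1 + e^{ωU/2})) dω = liebWuEnergy U`: the empirical densities of the `k_j`
and `Λ_α` converge (the whole sequence, by uniqueness of the solution of the Lieb–Wu integral
equations at `Q = π`, `B = ∞`) to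
`ρ₀(k) = 1/(2π) + (cos k/π) ∫₀^∞ cos(ω sin k) J₀(ω)/(1 + e^{ωU/2}) dω` and `σ₀`, and
`-2 ∫_{-π}^{π} ρ₀(k) cos k dk` is the displayed integral.
Goldbaum, CMP 258 (2005) 317, §5, eqs. (5.1)–(5.17) and the closing energy formula; Lieb–Wu,
Physica A 321 (2003) 1, §5 Theorem 1 and §6 (boxed formulas for `ρ₀`, `σ₀`, `E₀(N_a/2, N_a/2)`).
[cite: Goldbaum2005, §5] [cite: LiebWuPhysicaA2003, §6, boxed formula for E₀(N_a/2,N_a/2)] -/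
def liebWu_betheEnergy_tendsto : Prop :=
  ∀ (U : ℝ) (_hU : 0 < U) (k : ∀ m : ℕ, Fin (4 * m + 2) → ℝ) (Λ : ∀ m : ℕ, Fin (2 * m + 1) → ℝ)
    (_hk : ∀ m, IsLiebWuGroundRoots U m (k m) (Λ m)),
    Tendsto (fun m : ℕ => betheEnergy (k m) / (4 * m + 2 : ℝ)) atTop (𝓝 (Literature.Analysis.FunctionSpaces.liebWuEnergy U))

/-- **F4 (existence of the thermodynamic limit along even rings).** For `U > 0` the ground-state
energy per site of the half-filled Hubbard rings of even length `2n`, `t = 1`, converges as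
`n → ∞`. Not part of the Lieb–Wu analysis (which fixes `N_a = 2 × odd`); it is the standard
subadditivity argument: the open chains satisfy
`E^open_{L₁+L₂}(L₁+L₂) ≤ E^open_{L₁}(L₁) + E^open_{L₂}(L₂) + 4t` (product of ground states,
the connecting bond has norm `≤ 4t`), so `E^open_L(L)/L` converges by Fekete's lemma
(Mathlib `Subadditive.tendsto_lim`; bounded below by `-4t`), and
`|E^ring_L(L) - E^open_L(L)| ≤ 4t`. The argument gives the limit along all `L`; only even `L`
is needed for `lieb_wu`. [folklore] -/
def hubbardChain_energyPerSite_limit_exists : Prop :=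
  ∀ (U : ℝ) (_hU : 0 < U),
    ∃ e : ℝ, Tendsto (fun n : ℕ => energyPerSite (hubbardChain (2 * n)) 1 U (2 * n)) atTop (𝓝 e)

/-- **F5a (particle–hole symmetry of the sector ground-state energies on even rings).** On the
Hubbard ring of even length `2n` (bipartite), for every hopping `t`, interaction `U` and
`N ≤ 4n = 2|Λ|`: `E(N) = E(4n - N) - (2n - N) U`, the ground-state-energy form of
`E(M, M') = -(N_a - N) U + E(N_a - M, N_a - M')` (conjugation by the unitary particle–hole
transformation `c_{xσ} ↦ ε_x c†_{xσ}`, `ε` the bipartite sign, maps the `N`-sector onto the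
`(2|Λ| - N)`-sector and `H ↦ H - U N̂ + U|Λ|`; cf. the prelude fact
`QLattice.hamiltonian_particleHole_bipartite`). In particular `E(2n + 1) = E(2n - 1) + U`.
Lieb–Wu, Physica A 321 (2003) 1, §1, eq. (3); Essler et al. (2005) eq. (6.34).
[cite: LiebWuPhysicaA2003, §1 eq. (3)] -/
def hubbardChain_groundEnergyAt_particleHole : Prop :=
  ∀ (n : ℕ) (t U : ℝ) (N : ℕ) (_hN : N ≤ 4 * n),
    groundEnergyAt (hubbardChain (2 * n)) t U N =
      groundEnergyAt (hubbardChain (2 * n)) t U (4 * n - N) - ((2 * n : ℝ) - N) * U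

/-- **F5b (Lieb–Wu's `μ₋`).** For `U > 0`, along the half-filled Hubbard rings of even length
`2n → ∞` with `t = 1`, the energy to remove one electron, `E(2n) - E(2n - 1)`, converges to
`μ₋(U) = 2 - 4 ∫₀^∞ J₁(ω)/(ω(1 + e^{ωU/2})) dω` (`liebWuMuMinus U`). STATUS: announced in
Lieb–Wu 1968 and stated in this finite-difference form by Essler et al. (6.31)–(6.32); Lieb–Wu
2003 §7 define `μ₋` instead as the left derivative at `n = 1` of the convex infinite-volume energy
density and DERIVE the formula twice (§7.1: leading-order perturbation of the integral equations
in `a = π - Q`; §7.2: Bethe ansatz with `N_a - 4` electrons, sums replaced by integrals). Neither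
the derivations nor the identification with the limit of finite differences is proved in print;
this fact is vendored as printed and NOT weakened. Lieb–Wu, PRL 20 (1968) 1445; Physica A 321
(2003) 1, §7 (boxed `μ₋`); Essler et al. (2005) eqs. (6.31)–(6.32).
[cite: LiebWuPRL1968] [cite: LiebWuPhysicaA2003, §7] [cite: EsslerEtAl2005, eqs. (6.31)–(6.32)] -/
def liebWu_muMinus_tendsto : Prop :=
  ∀ (U : ℝ) (_hU : 0 < U),
    Tendsto (fun n : ℕ => groundEnergyAt (hubbardChain (2 * n)) 1 U (2 * n) -
      groundEnergyAt (hubbardChain (2 * n)) 1 U (2 * n - 1)) atTop (𝓝 (liebWuMuMinus U))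

/-! ### Assembly (proved) -/

/-- The fermionic ring `ℤ/Lℤ` has `L` sites. [folklore] -/
theorem card_fermionTorus_one (L : ℕ) : Fintype.card (FermionTorus 1 L) = L := by
  simp [FermionTorus, Fintype.card_lex]

/-- If the ground-state energy of the half-filled ring of `L` sites is a Bethe energy, the energy
per site is that Bethe energy divided by `L`. [cite: Goldbaum2005, §4] -/
theorem energyPerSite_eq_betheEnergy_div {U : ℝ} {L N : ℕ} {k : Fin N → ℝ}
    (hE : groundEnergyAt (hubbardChain L) 1 U L = betheEnergy k) :
    energyPerSite (hubbardChain L) 1 U L = betheEnergy k / L := by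
  rw [energyPerSite, hE, card_fermionTorus_one]

/-- **Part (i) of `lieb_wu` from F2, F3, F4.** Along `L = 4m + 2` the energy per site is a Bethe
energy per site (F2) and tends to `liebWuEnergy U` (F3); the full even sequence converges (F4),
hence to the same limit. [cite: Goldbaum2005, §5] [cite: LiebWuPhysicaA2003, §6] -/
theorem lieb_wu_energy_of (h₂ : liebWu_groundEnergyAt_eq_betheEnergy)
    (h₃ : liebWu_betheEnergy_tendsto) (h₄ : hubbardChain_energyPerSite_limit_exists)
    {U : ℝ} (hU : 0 < U) :
    Tendsto (fun n : ℕ => energyPerSite (hubbardChain (2 * n)) 1 U (2 * n)) atTop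
      (𝓝 (Literature.Analysis.FunctionSpaces.liebWuEnergy U)) := by
  obtain ⟨e, he⟩ := h₄ U hU
  choose k Λ hk using h₂ U hU
  have hlim : Tendsto (fun m : ℕ => betheEnergy (k m) / (4 * m + 2 : ℝ)) atTop
      (𝓝 (Literature.Analysis.FunctionSpaces.liebWuEnergy U)) := h₃ U hU k Λ fun m => (hk m).1
  -- the rings of `4m + 2` sites are the subsequence `n = 2m + 1` of the even rings
  have hsub : Tendsto (fun m : ℕ => 2 * m + 1) atTop atTop :=
    tendsto_atTop_atTop.2 fun b => ⟨b, fun a ha => by omega⟩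
  have key : ∀ (m L : ℕ), L = 4 * m + 2 →
      energyPerSite (hubbardChain L) 1 U L = betheEnergy (k m) / (4 * m + 2 : ℝ) := by
    rintro m L rfl
    rw [energyPerSite_eq_betheEnergy_div (hk m).2]
    push_cast
    ring
  have he' : Tendsto (fun m : ℕ => betheEnergy (k m) / (4 * m + 2 : ℝ)) atTop (𝓝 e) :=
    (he.comp hsub).congr fun m => key m (2 * (2 * m + 1)) (by ring)
  rwa [tendsto_nhds_unique he' hlim] at he

/-- **Part (ii) of `lieb_wu` from F5a, F5b.** By particle–hole symmetry `E(2n+1) = E(2n-1) + U`,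
so the charge gap is `U - 2 (E(2n) - E(2n-1)) → U - 2μ₋(U) = liebWuChargeGap U`.
[cite: LiebWuPhysicaA2003, §1 eq. (3) and §7] [cite: EsslerEtAl2005, eqs. (6.32)–(6.35)] -/
theorem lieb_wu_chargeGap_of (h₅ : hubbardChain_groundEnergyAt_particleHole)
    (h₆ : liebWu_muMinus_tendsto) {U : ℝ} (hU : 0 < U) :
    Tendsto (fun n : ℕ => chargeGap (hubbardChain (2 * n)) 1 U (2 * n)) atTop
      (𝓝 (Literature.Analysis.FunctionSpaces.liebWuChargeGap U)) := by
  have hlim : Tendsto (fun n : ℕ => U - 2 * (groundEnergyAt (hubbardChain (2 * n)) 1 U (2 * n) -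
      groundEnergyAt (hubbardChain (2 * n)) 1 U (2 * n - 1))) atTop (𝓝 (Literature.Analysis.FunctionSpaces.liebWuChargeGap U)) := by
    rw [liebWuChargeGap_eq_muMinus]
    exact tendsto_const_nhds.sub ((h₆ U hU).const_mul 2)
  refine hlim.congr' ?_
  filter_upwards [eventually_ge_atTop 1] with n hn
  have hph := h₅ n 1 U (2 * n - 1) (by omega)
  have e1 : 4 * n - (2 * n - 1) = 2 * n + 1 := by omega
  have e2 : (((2 * n - 1 : ℕ) : ℝ)) = 2 * n - 1 := by
    rw [Nat.cast_sub (by omega : 1 ≤ 2 * n)]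
    push_cast
    ring
  rw [e1, e2] at hph
  rw [chargeGap, hph]
  ring

/-- **Assembly of `lieb_wu`** from the named facts F2 (Bethe state = ground state on the rings of
`4m + 2` sites), F3 (thermodynamic limit of the Bethe energies), F4 (existence of the limit along
even rings), F5a (particle–hole symmetry) and F5b (Lieb–Wu's `μ₋`). The unconditional
`lieb_wu_holds` awaits the discharge of these facts (see the module docstring for their status).
[cite: LiebWuPRL1968] [cite: LiebWuPhysicaA2003, §§3–7] [cite: Goldbaum2005, Thm 1.1, §§4–5] -/
theorem lieb_wu_of (h₂ : liebWu_groundEnergyAt_eq_betheEnergy) (h₃ : liebWu_betheEnergy_tendsto)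
    (h₄ : hubbardChain_energyPerSite_limit_exists) (h₅ : hubbardChain_groundEnergyAt_particleHole)
    (h₆ : liebWu_muMinus_tendsto) : lieb_wu := fun _U hU =>
  ⟨lieb_wu_energy_of h₂ h₃ h₄ hU, lieb_wu_chargeGap_of h₅ h₆ hU⟩

/-- F2 implies F1 (the roots it provides are ground-state roots). [cite: Goldbaum2005, Thm 1.1] -/
theorem goldbaum_liebWuGroundRoots_exists_of (h₂ : liebWu_groundEnergyAt_eq_betheEnergy) :
    goldbaum_liebWuGroundRoots_exists := fun U hU m =>
  let ⟨k, Λ, hk, _⟩ := h₂ U hU m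
  ⟨k, Λ, hk⟩

/-- **Part (i) of `lieb_wu` from F1, F2′, F3, F4.** Choose ground-state roots on every ring of
`4m + 2` sites (F1); for `m ≥ 1` the energy per site is their Bethe energy per site (F2′), which
tends to `liebWuEnergy U` (F3); the full even sequence converges (F4), hence to the same limit.
[cite: Goldbaum2005, Thm 1.1, §§4–5] [cite: LiebWuPhysicaA2003, §6] -/
theorem lieb_wu_energy_of' (h₁ : goldbaum_liebWuGroundRoots_exists)
    (h₂ : liebWu_groundEnergyAt_eq_betheEnergy') (h₃ : liebWu_betheEnergy_tendsto)
    (h₄ : hubbardChain_energyPerSite_limit_exists) {U : ℝ} (hU : 0 < U) :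
    Tendsto (fun n : ℕ => energyPerSite (hubbardChain (2 * n)) 1 U (2 * n)) atTop
      (𝓝 (Literature.Analysis.FunctionSpaces.liebWuEnergy U)) := by
  obtain ⟨e, he⟩ := h₄ U hU
  -- ground-state roots on every ring, identifying the energy for `m ≥ 1`
  have hroots : ∀ m : ℕ, ∃ (k : Fin (4 * m + 2) → ℝ) (Λ : Fin (2 * m + 1) → ℝ),
      IsLiebWuGroundRoots U m k Λ ∧
        (1 ≤ m → groundEnergyAt (hubbardChain (4 * m + 2)) 1 U (4 * m + 2) = betheEnergy k) := by
    intro m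
    rcases Nat.eq_zero_or_pos m with rfl | hm
    · obtain ⟨k, Λ, hk⟩ := h₁ U hU 0
      exact ⟨k, Λ, hk, fun h => absurd h (by norm_num)⟩
    · obtain ⟨k, Λ, hk, hE⟩ := h₂ U hU m hm
      exact ⟨k, Λ, hk, fun _ => hE⟩
  choose k Λ hk using hroots
  have hlim : Tendsto (fun m : ℕ => betheEnergy (k m) / (4 * m + 2 : ℝ)) atTop
      (𝓝 (Literature.Analysis.FunctionSpaces.liebWuEnergy U)) := h₃ U hU k Λ fun m => (hk m).1
  -- the rings of `4m + 2` sites are the subsequence `n = 2m + 1` of the even rings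
  have hsub : Tendsto (fun m : ℕ => 2 * m + 1) atTop atTop :=
    tendsto_atTop_atTop.2 fun b => ⟨b, fun a ha => by omega⟩
  have key : ∀ (m L : ℕ), 1 ≤ m → L = 4 * m + 2 →
      energyPerSite (hubbardChain L) 1 U L = betheEnergy (k m) / (4 * m + 2 : ℝ) := by
    rintro m L hm rfl
    rw [energyPerSite_eq_betheEnergy_div ((hk m).2 hm)]
    push_cast
    ring
  have he' : Tendsto (fun m : ℕ => betheEnergy (k m) / (4 * m + 2 : ℝ)) atTop (𝓝 e) := by
    refine (he.comp hsub).congr' ?_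
    filter_upwards [eventually_ge_atTop 1] with m hm
    exact key m (2 * (2 * m + 1)) hm (by ring)
  rwa [tendsto_nhds_unique he' hlim] at he

/-- **Assembly of `lieb_wu`** from F1 (existence of ground-state roots on all rings of `4m + 2`
sites), F2′ (Bethe state = ground state for `N_a = 4m + 2 ≥ 6`), F3 (thermodynamic limit of the
Bethe energies), F4 (existence of the limit along even rings), F5a (particle–hole symmetry) and
F5b (Lieb–Wu's `μ₋`). This supersedes `lieb_wu_of` (whose hypothesis F2 is false at `m = 0`).
[cite: LiebWuPRL1968] [cite: LiebWuPhysicaA2003, §§2–7] [cite: Goldbaum2005, Thm 1.1, §§4–5] -/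
theorem lieb_wu_of_roots (h₁ : goldbaum_liebWuGroundRoots_exists)
    (h₂ : liebWu_groundEnergyAt_eq_betheEnergy') (h₃ : liebWu_betheEnergy_tendsto)
    (h₄ : hubbardChain_energyPerSite_limit_exists) (h₅ : hubbardChain_groundEnergyAt_particleHole)
    (h₆ : liebWu_muMinus_tendsto) : lieb_wu := fun _U hU =>
  ⟨lieb_wu_energy_of' h₁ h₂ h₃ h₄ hU, lieb_wu_chargeGap_of h₅ h₆ hU⟩

/-- F2 trivially implies F2′. [cite: Goldbaum2005, §4] -/
theorem liebWu_groundEnergyAt_eq_betheEnergy'_of (h₂ : liebWu_groundEnergyAt_eq_betheEnergy) :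
    liebWu_groundEnergyAt_eq_betheEnergy' := fun U hU m _ => h₂ U hU m

/-- **F2 = F2′ ∧ (its instance `m = 0`).** The node F2 (all `m`) is exactly the conjunction of
F2′ (`m ≥ 1`, the rings of `4m + 2 ≥ 6` sites covered by the sources) and its instance on the ring
of two sites, `N_a = N = 2`, `M = 1` — the instance that is FALSE for `hubbardChain 2`
(`LiebWuBetheAnsatzProofs.not_liebWu_groundEnergyAt_eq_betheEnergy`: the Lieb–Wu equations with
`N_a = 2` describe Lieb–Wu's doubly-bonded two-site ring, Physica A 321 (2003) 1, §2, not the single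
bond of `hubbardChain 2`). This isolates what is mis-stated in F2. [cite: Goldbaum2005, §4]
[cite: LiebWuPhysicaA2003, §2] -/
theorem liebWu_groundEnergyAt_eq_betheEnergy_iff :
    liebWu_groundEnergyAt_eq_betheEnergy ↔
      liebWu_groundEnergyAt_eq_betheEnergy' ∧
        ∀ (U : ℝ) (_hU : 0 < U), ∃ (k : Fin (4 * 0 + 2) → ℝ) (Λ : Fin (2 * 0 + 1) → ℝ),
          IsLiebWuGroundRoots U 0 k Λ ∧
            groundEnergyAt (hubbardChain (4 * 0 + 2)) 1 U (4 * 0 + 2) = betheEnergy k := by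
  refine ⟨fun h => ⟨liebWu_groundEnergyAt_eq_betheEnergy'_of h, fun U hU => h U hU 0⟩, ?_⟩
  rintro ⟨h', h0⟩ U hU m
  rcases Nat.eq_zero_or_pos m with rfl | hm
  · exact h0 U hU
  · exact h' U hU m hm

/-! ### Discharged nodes -/

/-- **F5a holds**: particle–hole symmetry of the sector ground-state energies on the even ring,
from `QLattice.groundEnergyAt_hubbardRing_particleHole` (`HubbardModelParticleHoleProofs`).
Lieb–Wu, Physica A 321 (2003) 1, §1 eq. (3). [cite: LiebWuPhysicaA2003, §1 eq. (3)] -/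
theorem hubbardChain_groundEnergyAt_particleHole_holds : hubbardChain_groundEnergyAt_particleHole :=
  fun n t U N hN => QuantumLattice.groundEnergyAt_hubbardRing_particleHole n t U N hN

/-- `lieb_wu` from F2, F3, F4 and F5b (F5a being discharged).
[cite: LiebWuPRL1968] [cite: Goldbaum2005, §§4–5] [cite: LiebWuPhysicaA2003, §§6–7] -/
theorem lieb_wu_of' (h₂ : liebWu_groundEnergyAt_eq_betheEnergy) (h₃ : liebWu_betheEnergy_tendsto)
    (h₄ : hubbardChain_energyPerSite_limit_exists) (h₆ : liebWu_muMinus_tendsto) : lieb_wu :=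
  lieb_wu_of h₂ h₃ h₄ hubbardChain_groundEnergyAt_particleHole_holds h₆

/-- **F4 holds**: the thermodynamic limit of the energy per site of the half-filled ring exists
along the even rings, from `QLattice.ThermodynamicLimit.hubbardRing_energyPerSite_limit_exists`
(`HubbardModelThermodynamicLimitProofs`, Fekete). [folklore] -/
theorem hubbardChain_energyPerSite_limit_exists_holds : hubbardChain_energyPerSite_limit_exists :=
  fun _ hU => ThermodynamicLimit.hubbardRing_energyPerSite_limit_exists 1 hU.le

/-- `lieb_wu` from the three remaining named facts F2 (Bethe state = ground state on the rings of
`4m + 2` sites), F3 (thermodynamic limit of the Bethe energies) and F5b (Lieb–Wu's `μ₋`).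
[cite: LiebWuPRL1968] [cite: Goldbaum2005, §§4–5] [cite: LiebWuPhysicaA2003, §§6–7] -/
theorem lieb_wu_of_bethe (h₂ : liebWu_groundEnergyAt_eq_betheEnergy) (h₃ : liebWu_betheEnergy_tendsto)
    (h₆ : liebWu_muMinus_tendsto) : lieb_wu :=
  lieb_wu_of' h₂ h₃ hubbardChain_energyPerSite_limit_exists_holds h₆

/-- `lieb_wu` from the named facts F1 (Goldbaum's existence theorem), F2′ (Bethe state = ground
state on the rings of `4m + 2 ≥ 6` sites), F3 (thermodynamic limit of the Bethe energies) and F5b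
(Lieb–Wu's `μ₋`), F4 and F5a being discharged. The remaining route to `lieb_wu_holds`.
[cite: LiebWuPRL1968] [cite: Goldbaum2005, Thm 1.1, §§4–5] [cite: LiebWuPhysicaA2003, §§6–7] -/
theorem lieb_wu_of_roots' (h₁ : goldbaum_liebWuGroundRoots_exists)
    (h₂ : liebWu_groundEnergyAt_eq_betheEnergy') (h₃ : liebWu_betheEnergy_tendsto)
    (h₆ : liebWu_muMinus_tendsto) : lieb_wu :=
  lieb_wu_of_roots h₁ h₂ h₃ hubbardChain_energyPerSite_limit_exists_holds
    hubbardChain_groundEnergyAt_particleHole_holds h₆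

end Literature.MathematicalPhysics.QuantumLattice
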